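import Summits.QuantumFields.YangMills.Theorems.BalabanLadderIRAfOnsetLargeUnit
import Summits.QuantumFields.YangMills.Theorems.BalabanLadderIROddTorusLargeFieldRaritySharp

/-!
# Crux `IR` (stmt-QuantumFields-19354), line `af-pincer`, stub `stub_afOnsetUc : AFToOnsetUKPc` (X-side):
# plaquette-cost moments at weak coupling, uniformly in the odd torus (lattice-scale asymptotic freedom, part 1/3)

Helper of seat ym-19354-afpincer-s2 for the X-stub of the registered slot `af-pincer-Uc` (sha16 b6e69d9662b5b07a).
`Theorems/BalabanLadderIRAfOnsetLargeUnit` settled the end of the stub where the unit `s` is large.  Parts 1–3 add the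
weak-coupling input the tree already certifies — the odd-torus chessboard estimate
`OddTorusChessboard.measureReal_forall_le_cellAction_le_pow_rep_sharp` (Fröhlich–Israel–Lieb–Simon) — and prove that the
BARE action density decorrelates at rate `(1 + log β)²/β²` UNIFORMLY IN THE VOLUME; part 3
(`…AfOnsetLatticeAF`) turns this into the X-clause of `AFToOnsetUKPc` on every tail where the onset grows at most like
`(β / log β)^{1/4}`.  This part:

* §1 `integral_le_of_tail` — layer-cake in one step: `0 ≤ φ ≤ B`, `μ{T ≤ φ} ≤ p` ⟹ `∫ φ ≤ T + B p`, `∫ φ² ≤ T² + B² p`.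
* §2 `one_add_log_sq_le` (`(1 + log β)² ≤ 4β`), **`exists_plaquetteCost_moments_le`** — for a lattice representation
  `r`, on every odd four-torus `2L+1 ≥ 3` and every `β ≥ 1`: `⟨φ_q⟩ ≤ K (1 + log β)/β` and `⟨φ_q²⟩ ≤ K (1 + log β)²/β²`
  for every plaquette cost `φ_q = N − Re tr r(U_q)` (chessboard tail `μ{φ_q ≥ T} ≤ exp(−βT/m + (K₀ + D₁ log β)/m)`,
  `m = 6` orientations, at `T = (|K₀| + (D₁ + 2m) log β)/β`, which is `≤ β⁻²`).

HONEST FRAMING.  Lattice-scale weak-coupling bookkeeping (the plaquette energy is `O(log β / β)` uniformly in the volume)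
around ONE open stub of one open gap-crux of a CONDITIONAL chain; no decay in the lattice distance is proved or claimed;
nothing here is a gap statement.  Refs: Fröhlich–Israel–Lieb–Simon, CMP 62 (1978) §4–5.
-/

set_option autoImplicit false

noncomputable section

open MeasureTheory Filter Topology Finset
open scoped BigOperators SchwartzMap
open Literature.MathematicalPhysics.QuantumFieldTheory hiding ZdEdge
open Literature.MathematicalPhysics.QuantumLattice
open Literature.Probability.LatticeModels (Site box mem_box)
open Summit.QuantumFields.YangMills.Cruxes.OSLegsFromFemtoAndGap.DlrCollarTransfer
open Summit.QuantumFields.YangMills.Theorems.OSLegsFromFemtoAndGap (sum_decay_le summable_inv_succ_sq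
  mul_norm_le_norm_smul_siteToE)
open Literature.MathematicalPhysics.QuantumFieldTheory.WilsonRP (plaqRe abs_plaqRe_le measurable_plaqRe)
open Summit.QuantumFields.YangMills.Theorems.OddTorusChessboard (Orient
  measureReal_forall_le_cellAction_le_pow_rep_sharp)

namespace Summit.QuantumFields.YangMills.Cruxes.IR.AfOnset

/-! ## §1 Layer-cake in one step -/
section Tail

variable {Ω : Type*} [MeasurableSpace Ω] {μ : Measure Ω} [IsProbabilityMeasure μ]

/-- **First and second moments from ONE tail bound**: for a measurable `0 ≤ φ ≤ B` on a probability space and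
`μ{T ≤ φ} ≤ p` (`T ≥ 0`): `∫ φ ≤ T + B p` and `∫ φ² ≤ T² + B² p` (pointwise `φ ≤ T + B·1_{T ≤ φ}`,
`φ² ≤ T² + B²·1_{T ≤ φ}`). [folklore] -/
theorem integral_le_of_tail {φ : Ω → ℝ} (hφm : Measurable φ) {B : ℝ} (hB : 0 ≤ B) (hφ0 : ∀ ω, 0 ≤ φ ω)
    (hφB : ∀ ω, φ ω ≤ B) {T p : ℝ} (hT : 0 ≤ T) (htail : μ.real {ω | T ≤ φ ω} ≤ p) :
    (∫ ω, φ ω ∂μ ≤ T + B * p) ∧ (∫ ω, φ ω ^ 2 ∂μ ≤ T ^ 2 + B ^ 2 * p) := by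
  set S : Set Ω := {ω | T ≤ φ ω} with hSdef
  have hS : MeasurableSet S := measurableSet_le measurable_const hφm
  have hind : Integrable (fun ω => S.indicator (1 : Ω → ℝ) ω) μ := (integrable_const (1 : ℝ)).indicator hS
  have hI1 : ∫ ω, S.indicator (1 : Ω → ℝ) ω ∂μ = μ.real S := integral_indicator_one hS
  have hφint : Integrable φ μ :=
    integrable_of_bound hφm.aestronglyMeasurable (C := B) fun ω => by
      rw [abs_of_nonneg (hφ0 ω)]; exact hφB ω
  have hφ2int : Integrable (fun ω => φ ω ^ 2) μ :=
    integrable_of_bound (hφm.pow_const 2).aestronglyMeasurable (C := B ^ 2) fun ω => by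
      rw [abs_of_nonneg (sq_nonneg _)]; exact pow_le_pow_left₀ (hφ0 ω) (hφB ω) 2
  have hind_val : ∀ ω, S.indicator (1 : Ω → ℝ) ω = if T ≤ φ ω then 1 else 0 := by
    intro ω
    by_cases h : T ≤ φ ω
    · rw [if_pos h, Set.indicator_of_mem (show ω ∈ S from h)]; rfl
    · rw [if_neg h, Set.indicator_of_notMem (show ω ∉ S from h)]
  have hpt1 : ∀ ω, φ ω ≤ T + B * S.indicator (1 : Ω → ℝ) ω := by
    intro ω
    rw [hind_val]
    by_cases h : T ≤ φ ω
    · rw [if_pos h, mul_one]; linarith [hφB ω]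
    · rw [if_neg h, mul_zero, add_zero]; exact (not_le.1 h).le
  have hpt2 : ∀ ω, φ ω ^ 2 ≤ T ^ 2 + B ^ 2 * S.indicator (1 : Ω → ℝ) ω := by
    intro ω
    rw [hind_val]
    by_cases h : T ≤ φ ω
    · rw [if_pos h, mul_one]
      nlinarith [pow_le_pow_left₀ (hφ0 ω) (hφB ω) 2, sq_nonneg T]
    · rw [if_neg h, mul_zero, add_zero]
      exact pow_le_pow_left₀ (hφ0 ω) (not_le.1 h).le 2
  have hμS : μ.real S ≤ p := htail
  constructor
  · calc ∫ ω, φ ω ∂μ ≤ ∫ ω, (T + B * S.indicator (1 : Ω → ℝ) ω) ∂μ :=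
          integral_mono hφint ((integrable_const T).add (hind.const_mul B)) hpt1
      _ = T + B * μ.real S := by
          rw [integral_add (integrable_const T) (hind.const_mul B), integral_const_mul, hI1, integral_const]
          simp
      _ ≤ T + B * p := by gcongr
  · calc ∫ ω, φ ω ^ 2 ∂μ ≤ ∫ ω, (T ^ 2 + B ^ 2 * S.indicator (1 : Ω → ℝ) ω) ∂μ :=
          integral_mono hφ2int ((integrable_const _).add (hind.const_mul _)) hpt2
      _ = T ^ 2 + B ^ 2 * μ.real S := by
          rw [integral_add (integrable_const _) (hind.const_mul _), integral_const_mul, hI1, integral_const]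
          simp
      _ ≤ T ^ 2 + B ^ 2 * p := by gcongr

end Tail

/-! ## §2 Plaquette-cost moments at weak coupling, uniformly in the odd torus -/
section Plaquette

variable {G : Type} [Group G] [TopologicalSpace G] [IsTopologicalGroup G] [CompactSpace G]
  [MeasurableSpace G] [BorelSpace G] (r : LatticeRep G)

/-- `(1 + log β)² ≤ 4 β` for `β ≥ 1` (`log β = 2 log √β ≤ 2(√β − 1)`). [folklore] -/
theorem one_add_log_sq_le {β : ℝ} (hβ : 1 ≤ β) : (1 + Real.log β) ^ 2 ≤ 4 * β := by
  have hβ0 : 0 ≤ β := le_trans zero_le_one hβ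
  have hs0 : 0 < Real.sqrt β := Real.sqrt_pos.2 (lt_of_lt_of_le one_pos hβ)
  have h1 : Real.log β = 2 * Real.log (Real.sqrt β) := by
    rw [Real.log_sqrt hβ0]; ring
  have h2 : Real.log (Real.sqrt β) ≤ Real.sqrt β - 1 := Real.log_le_sub_one_of_pos hs0
  have h3 : 0 ≤ Real.log β := Real.log_nonneg hβ
  have h4 : 1 + Real.log β ≤ 2 * Real.sqrt β := by linarith
  have h5 : 0 ≤ 1 + Real.log β := by linarith
  calc (1 + Real.log β) ^ 2 ≤ (2 * Real.sqrt β) ^ 2 := pow_le_pow_left₀ h5 h4 2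
    _ = 4 * β := by rw [mul_pow, Real.sq_sqrt hβ0]; ring

/-- **Plaquette-cost moments at weak coupling, uniformly in the volume.**  For a lattice representation `r` there is
`K ≥ 0` such that on every odd four-torus of side `2L+1 ≥ 3` and at every `β ≥ 1`, for every plaquette `q`:
`⟨φ_q⟩_{β} ≤ K (1 + log β)/β` and `⟨φ_q²⟩_{β} ≤ K (1 + log β)²/β²`, `φ_q = N − Re tr r(U_q) ∈ [0, 2N]`.  Proof: the
tree's chessboard tail (`measureReal_forall_le_cellAction_le_pow_rep_sharp`, one cell, one plaquette, `λ = β`) at the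
threshold `T = (|K₀| + (D₁ + 2m) log β)/β` is `≤ β⁻²`; then §1. [folklore] -/
theorem exists_plaquetteCost_moments_le :
    ∃ K : ℝ, 0 ≤ K ∧ ∀ (L : ℕ), 1 ≤ L → ∀ β : ℝ, 1 ≤ β → ∀ q : Plaquette 4 (2 * L + 1),
      (∫ U, plaquetteCost r.ρ U q ∂(wilsonMeasure (d := 4) (L := 2 * L + 1) r.ρ β) ≤
          K * (1 + Real.log β) / β) ∧
      (∫ U, (plaquetteCost r.ρ U q) ^ 2 ∂(wilsonMeasure (d := 4) (L := 2 * L + 1) r.ρ β) ≤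
          K * (1 + Real.log β) ^ 2 / β ^ 2) := by
  haveI : SecondCountableTopology G :=
    (r.continuous.isClosedEmbedding r.injective).isEmbedding.secondCountableTopology
  obtain ⟨K₀, D₁, hch⟩ := measureReal_forall_le_cellAction_le_pow_rep_sharp r
  set m : ℝ := (Fintype.card (Orient 4) : ℝ) with hmdef
  have hmcard : 0 < Fintype.card (Orient 4) :=
    Fintype.card_pos_iff.2 ⟨⟨((0 : Fin 4), (1 : Fin 4)), by decide⟩⟩
  have hm : 0 < m := by rw [hmdef]; exact_mod_cast hmcard
  set N : ℝ := (r.N : ℝ) with hNdef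
  have hN0 : 0 ≤ N := Nat.cast_nonneg _
  set K₁ : ℝ := |K₀| + (D₁ : ℝ) + 2 * m with hK₁
  have hK₁0 : 0 ≤ K₁ := by positivity
  refine ⟨K₁ ^ 2 + K₁ + 4 * N ^ 2 + 2 * N, by positivity, fun L hL β hβ q => ?_⟩
  have hβ0 : 0 < β := lt_of_lt_of_le one_pos hβ
  have hℓ0 : 0 ≤ Real.log β := Real.log_nonneg hβ
  have hodd : Odd (2 * L + 1) := odd_two_mul_add_one L
  have h3 : 3 ≤ 2 * L + 1 := by omega
  haveI := isProbabilityMeasure_wilsonMeasure (d := 4) (L := 2 * L + 1) r.ρ r.continuous β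
  -- the threshold and the tail
  set T₀ : ℝ := (|K₀| + ((D₁ : ℝ) + 2 * m) * Real.log β) / β with hT₀
  have hT₀0 : 0 ≤ T₀ := by positivity
  have htail0 := hch hodd h3 β hβ β hβ0.le le_rfl (Finset.univ : Finset Unit) (fun _ => ({q} : Finset _))
    (fun i _ j _ hij => absurd (Subsingleton.elim i j) hij) 1 (fun i _ => by simp) T₀
  have hset : {U : GaugeConfig 4 (2 * L + 1) G | ∀ i ∈ (Finset.univ : Finset Unit),
      T₀ ≤ ∑ q' ∈ ({q} : Finset (Plaquette 4 (2 * L + 1))), plaquetteCost r.ρ U q'} =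
      {U | T₀ ≤ plaquetteCost r.ρ U q} := by
    ext U; simp
  rw [hset, Finset.card_univ, Fintype.card_unit, pow_one, Nat.cast_one, one_mul] at htail0
  have hexp : Real.exp (-(β * T₀) / (Fintype.card (Orient 4) : ℝ) +
      (K₀ + (D₁ : ℝ) * Real.log β) / (Fintype.card (Orient 4) : ℝ)) ≤ (β ^ 2)⁻¹ := by
    rw [← hmdef]
    have hβT : β * T₀ = |K₀| + ((D₁ : ℝ) + 2 * m) * Real.log β := by
      rw [hT₀]; field_simp
    have hle : -(β * T₀) / m + (K₀ + (D₁ : ℝ) * Real.log β) / m ≤ -(2 * Real.log β) := by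
      rw [hβT, ← add_div, div_le_iff₀ hm]
      nlinarith [le_abs_self K₀, hℓ0, hm]
    calc Real.exp (-(β * T₀) / m + (K₀ + (D₁ : ℝ) * Real.log β) / m)
        ≤ Real.exp (-(2 * Real.log β)) := Real.exp_le_exp.2 hle
      _ = (β ^ 2)⁻¹ := by
          rw [Real.exp_neg, show 2 * Real.log β = Real.log (β ^ 2) by rw [Real.log_pow]; norm_num,
            Real.exp_log (pow_pos hβ0 2)]
  have htail : (wilsonMeasure (d := 4) (L := 2 * L + 1) r.ρ β).real {U | T₀ ≤ plaquetteCost r.ρ U q} ≤ (β ^ 2)⁻¹ :=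
    htail0.trans hexp
  -- the cost is measurable and lies in `[0, 2N]`
  have hmeas : Measurable fun U : GaugeConfig 4 (2 * L + 1) G => plaquetteCost r.ρ U q :=
    measurable_const.sub (measurable_plaqRe r.ρ r.continuous q)
  have hbd : ∀ U : GaugeConfig 4 (2 * L + 1) G, 0 ≤ plaquetteCost r.ρ U q ∧ plaquetteCost r.ρ U q ≤ 2 * N := by
    intro U
    have h := abs_le.1 (abs_plaqRe_le r.ρ r.continuous U q)
    change 0 ≤ (r.N : ℝ) - plaqRe r.ρ U q ∧ (r.N : ℝ) - plaqRe r.ρ U q ≤ 2 * N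
    rw [← hNdef] at h ⊢
    constructor <;> linarith [h.1, h.2]
  obtain ⟨hI1, hI2⟩ := integral_le_of_tail (μ := wilsonMeasure (d := 4) (L := 2 * L + 1) r.ρ β) hmeas
    (by positivity : (0 : ℝ) ≤ 2 * N) (fun U => (hbd U).1) (fun U => (hbd U).2) hT₀0 htail
  -- arithmetic: `T₀ ≤ K₁ (1 + log β)/β`, `β⁻² ≤ (1 + log β)/β`, `β⁻² ≤ (1 + log β)²/β²`
  have hT₀le : T₀ ≤ K₁ * (1 + Real.log β) / β := by
    rw [hT₀, div_le_div_iff_of_pos_right hβ0, hK₁]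
    nlinarith [abs_nonneg K₀, hℓ0, hm.le, (Nat.cast_nonneg D₁ : (0 : ℝ) ≤ D₁)]
  have hinv1 : (β ^ 2)⁻¹ ≤ (1 + Real.log β) / β := by
    rw [inv_eq_one_div, div_le_div_iff₀ (pow_pos hβ0 2) hβ0]
    nlinarith
  have hinv2 : (β ^ 2)⁻¹ ≤ (1 + Real.log β) ^ 2 / β ^ 2 := by
    rw [inv_eq_one_div]
    exact div_le_div_of_nonneg_right (by nlinarith) (pow_pos hβ0 2).le
  have hfrac0 : 0 ≤ (1 + Real.log β) / β := by positivity
  have hfrac2 : 0 ≤ (1 + Real.log β) ^ 2 / β ^ 2 := by positivity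
  constructor
  · calc ∫ U, plaquetteCost r.ρ U q ∂(wilsonMeasure (d := 4) (L := 2 * L + 1) r.ρ β)
        ≤ T₀ + 2 * N * (β ^ 2)⁻¹ := hI1
      _ ≤ K₁ * (1 + Real.log β) / β + 2 * N * ((1 + Real.log β) / β) := by gcongr
      _ = (K₁ + 2 * N) * (1 + Real.log β) / β := by ring
      _ ≤ (K₁ ^ 2 + K₁ + 4 * N ^ 2 + 2 * N) * (1 + Real.log β) / β := by
          rw [mul_div_assoc, mul_div_assoc]
          exact mul_le_mul_of_nonneg_right (by nlinarith [sq_nonneg K₁, sq_nonneg N]) hfrac0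
  · have hT₀sq : T₀ ^ 2 ≤ K₁ ^ 2 * (1 + Real.log β) ^ 2 / β ^ 2 :=
      calc T₀ ^ 2 ≤ (K₁ * (1 + Real.log β) / β) ^ 2 := pow_le_pow_left₀ hT₀0 hT₀le 2
        _ = K₁ ^ 2 * (1 + Real.log β) ^ 2 / β ^ 2 := by rw [div_pow, mul_pow]
    calc ∫ U, (plaquetteCost r.ρ U q) ^ 2 ∂(wilsonMeasure (d := 4) (L := 2 * L + 1) r.ρ β)
        ≤ T₀ ^ 2 + (2 * N) ^ 2 * (β ^ 2)⁻¹ := hI2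
      _ ≤ K₁ ^ 2 * (1 + Real.log β) ^ 2 / β ^ 2 + (2 * N) ^ 2 * ((1 + Real.log β) ^ 2 / β ^ 2) := by gcongr
      _ = (K₁ ^ 2 + 4 * N ^ 2) * (1 + Real.log β) ^ 2 / β ^ 2 := by ring
      _ ≤ (K₁ ^ 2 + K₁ + 4 * N ^ 2 + 2 * N) * (1 + Real.log β) ^ 2 / β ^ 2 := by
          rw [mul_div_assoc, mul_div_assoc]
          exact mul_le_mul_of_nonneg_right (by nlinarith) hfrac2

end Plaquette

end Summit.QuantumFields.YangMills.Cruxes.IR.AfOnset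

end
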